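/-
Copyright (c) 2026. All rights reserved.
Released under Apache 2.0 license as described in the file LICENSE.
-/
import Literature.Geometry.Kaehler.ComplexTorusQuaternionXSixEllipticPoints
import Literature.Geometry.Kaehler.ComplexTorusQuaternionXSixEllipticOrderThree
import Literature.Geometry.Kaehler.ComplexTorusQuaternionXSixAtkinLehnerFixedPoints
import Literature.Geometry.Kaehler.ComplexTorusQuaternionHeckeCMPoints
import Literature.Geometry.Kaehler.ComplexTorusQuaternionHeckeIsogenies
import Literature.Geometry.Kaehler.ComplexTorusQuaternionSpecialCyclePoints
import Literature.Geometry.Kaehler.ComplexTorusQuaternionImaginaryAxis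
import Literature.Geometry.Kaehler.ComplexTorusQuaternionCMPointsModTwo
import Literature.Geometry.Kaehler.ComplexTorusQuaternionNormThreeCMPoint
import HarnessLib

/-!
# `e₂(Γ₆) = 2` and `e₃(Γ₆) = 2` AS NUMBERS: the elliptic points of order `2` and of order `3` of the Shimura curve
# `X₆ = Γ₆∖ℌ`, as quotient types of fixed points in `ℌ` by `Γ₆`-equivalence, have `Nat.card = 2`

[tag: complex_torus] [tag: abelian_surface] [tag: quaternion_multiplication] [tag: complex_multiplication]
[tag: shimura_curve] [tag: elliptic_points] [tag: fuchsian_group]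

The sibling file `…XSixEllipticPoints` proves the two halves of «`e₂(Γ₆) = e₃(Γ₆) = 2`» representative-wise: the fixed
points of `ρ(i)` and of `ρ(E)`, `E = −2i + ij`, are not `Γ₆`-equivalent and every fixed point in `ℂ ∖ ℝ` of an order-`4`
element of `Γ₆` is `Γ₆`-equivalent to one of them (`orderTwo_points_not_equiv`, `orderTwo_points_complete`), and likewise
for `R₁ = 3i + j + ij`, `R₂ = 3i + j − ij` and the elliptic elements of non-zero trace (`orderThree_points_not_equiv`,
`orderThree_points_complete`). This file turns them into the NUMBERS: with `Γ₆ = O₆¹` spelled «`u ∈ O₆` (`u ∈ 𝔬 ∨ u − e ∈ 𝔬`),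
`uū = 1`» acting on the upper half-plane through `ρ = rho (−1) 3 ∘ castQ` and `moebius`,

* the quotient of `{τ ∈ ℌ : ρ(u)τ = τ for some u ∈ Γ₆ with tr u = 0}` (fixed points of the order-`4` elements, i.e. the
  elliptic points of order `2` of `X₆ = Γ₆∖ℌ`) by `τ ∼ τ′ ⟺ ∃ v ∈ Γ₆, ρ(v)τ = τ′` has `Nat.card = 2` (`card_orderTwo_points`);
* the quotient of `{τ ∈ ℌ : ρ(u)τ = τ for some u ∈ Γ₆, u ≠ ±1, tr u ≠ 0}` (fixed points of the elements of order `3`, `6`,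
  i.e. the elliptic points of order `3`) by the same relation has `Nat.card = 2` (`card_orderThree_points`);

both as bare `Quot` types of relations written inline (no definitions). Representatives: `I` (fixed by `i`) and
`(2 + √3)I` (fixed by `E`; `moebius_rho_E_axisPoint`, from the imaginary-axis criterion `moebius_rho_eq_self_iff_of_re_eq_zero`);
`τ₃ = ((√3 − 1)/2)(1 + I)` (fixed by `R₁`, `moebius_rho_tauThree`) and `ρ(i)τ₃′` (fixed by `R₂ = i(3i − j + ij)i⁻¹`,
`moebius_rho_R₂_point`, transported from `moebius_rho_tauThreeBis` by `moebius_conj_fixed`).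

## Method

§0: `ρ(1)` acts trivially, `ρ(wv) = ρ(w)ρ(v)` on `ℌ` (`moebius_mul_of_det_pos`, `det ρ(v) = nr v = 1 > 0`), `ρ(v̄)` inverts
`ρ(v)` (`moebius_rho_star_moebius_rho`), and a trace-zero element of positive norm has a unique fixed point in `ℌ`
(`fixedPoint_unique_of_trace_eq_zero`) — so `Γ₆`-equivalence is an equivalence relation on each set of fixed points
(`orderTwo_points_equivalence`, `orderThree_points_equivalence`). §1–§2: `Nat.card_eq_two_iff` with the two classes:
distinct by the `not_equiv` theorems; exhaustive since `…_complete` moves any fixed point by some `v ∈ Γ₆` to a fixed point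
of `ρ(i)`/`ρ(E)` resp. `ρ(R₁)`/`ρ(R₂)` in `ℌ` (`im_moebius_rho_pos`), which by uniqueness is the chosen representative.

## Sources (the print, as quoted in `…XSixEllipticPoints`)

* M.-F. Vignéras, *Arithmétique des algèbres de quaternions*, LNM 800 (1980), Ch. IV §3 A («`e₂ = ∏_{p∣D}(1 − (−4/p))`,
  `e₃ = ∏_{p∣D}(1 − (−3/p))`»), Ch. IV §3 B, table «`D = 2·3`: `v_Γ = −1/3`, `e₂(Γ) = 2`, `e₃(Γ) = 2`, `g_Γ = 0`», Ch. IV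
  §1 (the quotient `Γ∖ℌ` and its elliptic points). [cite: VignerasLNM800, Ch. IV §3]
* P. Bayer, A. Travesa, *Uniformizing functions for certain Shimura curves, in the case `D = 6`*, Acta Arith. 126 (2007),
  §1 Thm. 1.1: «The vertices `P₁ ≡ P₃ ≡ P₅ (mod Γ₆)` and `P₆` are elliptic of order `2`; the remaining vertices `P₂, P₄`
  are elliptic of order `3`.» [cite: BayerTravesa2007, §1 Thm. 1.1]

## Scope (honest)

Theorems only — no definitions, no named facts, no instances, no notation. `X₆` itself is not constructed as a type: the
two counted sets are the quotient TYPES of the fixed-point sets in `ℌ` described above by the inline `Γ₆`-equivalence; an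
«elliptic point of order `2`» is taken to mean «fixed point of some `u ∈ Γ₆` with `tr u = 0`» and «of order `3`» to mean
«fixed point of some `u ∈ Γ₆`, `u ≠ ±1`, `tr u ≠ 0`» (by `…XSixEllipticElements` these are exactly the non-trivial
elliptic elements of `Γ₆`, of orders `4` resp. `3, 6` in `Γ₆`, orders `2` resp. `3` in `Γ₆/±1`); that dictionary, the
genus formula and the volume `v_Γ` are not formalised here (the arithmetic of the table row is `vigneras_table_D_six`).
-/

noncomputable section

set_option maxSynthPendingDepth 3

open Quaternion Function

namespace Literature.Geometry.Kaehler.ComplexTorus.QuaternionType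

/-! ## §0 Möbius bookkeeping for `Γ₆` on `ℌ` -/

section Moebius

/-- `ρ(1)` acts trivially. [folklore] -/
private theorem moebius_rho_castQ_one (τ : ℂ) :
    moebius (rho (-1) 3 (by norm_num) (castQ (-1) 3 (1 : ℍ[ℚ,((-1 : ℤ) : ℚ),((3 : ℤ) : ℚ)]))) τ = τ := by
  rw [castQ_one, map_one, moebius_apply]
  simp

/-- `ρ(wv)` acts as `ρ(w) ∘ ρ(v)` on `ℌ` for positive norms. [folklore] -/
private theorem moebius_rho_castQ_mul {v w : ℍ[ℚ,((-1 : ℤ) : ℚ),((3 : ℤ) : ℚ)]} (hv : 0 < (v * star v).re)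
    (hw : 0 < (w * star w).re) {τ : ℂ} (hτ : 0 < τ.im) :
    moebius (rho (-1) 3 (by norm_num) (castQ (-1) 3 (w * v))) τ =
      moebius (rho (-1) 3 (by norm_num) (castQ (-1) 3 w)) (moebius (rho (-1) 3 (by norm_num) (castQ (-1) 3 v)) τ) := by
  rw [castQ_mul, map_mul]
  exact moebius_mul_of_det_pos (det_rho_castQ_pos _ hw) (det_rho_castQ_pos _ hv) (UpperHalfPlane.mk τ hτ)

/-- A unit `v v̄ = 1` has reduced norm `1 > 0`. [folklore] -/
private theorem norm_pos_of_mul_star_eq_one {v : ℍ[ℚ,((-1 : ℤ) : ℚ),((3 : ℤ) : ℚ)]} (hv1 : v * star v = 1) :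
    0 < (v * star v).re := by
  rw [hv1, QuaternionAlgebra.re_one]; exact one_pos

/-- A trace-zero element of positive norm has at most one fixed point in `ℌ`. [folklore] -/
private theorem fixed_unique {x : ℍ[ℚ,((-1 : ℤ) : ℚ),((3 : ℤ) : ℚ)]} (hx : x.re = 0) (ht : 0 < (x * star x).re)
    {τ₁ τ₂ : ℂ} (h₁ : 0 < τ₁.im) (h₂ : 0 < τ₂.im)
    (hf₁ : moebius (rho (-1) 3 (by norm_num) (castQ (-1) 3 x)) τ₁ = τ₁)
    (hf₂ : moebius (rho (-1) 3 (by norm_num) (castQ (-1) 3 x)) τ₂ = τ₂) : τ₁ = τ₂ := by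
  have h := fixedPoint_unique_of_trace_eq_zero (trace_rho_castQ_eq_zero _ hx) (det_rho_castQ_pos _ ht)
    (τ₁ := UpperHalfPlane.mk τ₁ h₁) (τ₂ := UpperHalfPlane.mk τ₂ h₂) hf₁ hf₂
  exact congrArg UpperHalfPlane.coe h

end Moebius

/-! ## §1 The elliptic points of order `2`: `e₂(Γ₆) = 2` -/

section OrderTwo

/-- **`Γ₆`-EQUIVALENCE IS AN EQUIVALENCE RELATION on the fixed points in `ℌ` of the order-`4` elements of `Γ₆`** (trace `0`,
`uū = 1`): `τ ∼ τ'` iff `ρ(v)τ = τ'` for some `v ∈ Γ₆ = O₆¹` (`1`; `v̄ = v⁻¹`; `wv`). [cite: VignerasLNM800, Ch. IV §1 (points of `Γ∖ℌ`) and §3 A] -/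
theorem orderTwo_points_equivalence :
    Equivalence (fun p q : {τ : ℂ // 0 < τ.im ∧ ∃ u : ℍ[ℚ,((-1 : ℤ) : ℚ),((3 : ℤ) : ℚ)],
        (u ∈ order (-1) 3 ∨ u - ⟨1/2, 1/2, 1/2, -1/2⟩ ∈ order (-1) 3) ∧ u * star u = 1 ∧ u.re = 0 ∧
        moebius (rho (-1) 3 (by norm_num) (castQ (-1) 3 u)) τ = τ} ↦
      ∃ v : ℍ[ℚ,((-1 : ℤ) : ℚ),((3 : ℤ) : ℚ)], (v ∈ order (-1) 3 ∨ v - ⟨1/2, 1/2, 1/2, -1/2⟩ ∈ order (-1) 3) ∧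
        v * star v = 1 ∧ moebius (rho (-1) 3 (by norm_num) (castQ (-1) 3 v)) p.1 = q.1) where
  refl p := ⟨1, Or.inl (Subring.one_mem _), by rw [star_one, mul_one], moebius_rho_castQ_one _⟩
  symm := by
    rintro p q ⟨v, hv, hv1, h⟩
    refine ⟨star v, star_maxOrder hv, by rw [star_star, star_comm_self' v, hv1], ?_⟩
    rw [← h]
    exact moebius_rho_star_moebius_rho (by norm_num) (norm_pos_of_mul_star_eq_one hv1) (UpperHalfPlane.mk p.1 p.2.1)
  trans := by
    rintro p q r ⟨v, hv, hv1, h1⟩ ⟨w, hw, hw1, h2⟩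
    refine ⟨w * v, maxOrder_mul hw hv, by rw [star_mul, mul_assoc, ← mul_assoc v, hv1, one_mul, hw1], ?_⟩
    rw [moebius_rho_castQ_mul (norm_pos_of_mul_star_eq_one hv1) (norm_pos_of_mul_star_eq_one hw1) p.2.1, h1, h2]

/-- The fixed point `(2 + √3)·I ∈ ℌ` of `ρ(E)`, `E = −2i + ij` (on the imaginary axis: `−2(1 − y²) = √3(1 + y²)` at
`y = 2 + √3`). [cite: BayerTravesa2007, §1 Thm. 1.1 (the order-`2` vertices `P₁ ≡ P₃ ≡ P₅`)] -/
theorem moebius_rho_E_axisPoint :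
    moebius (rho (-1) 3 (by norm_num) (castQ (-1) 3 (⟨0, -2, 0, 1⟩ : ℍ[ℚ,((-1 : ℤ) : ℚ),((3 : ℤ) : ℚ)])))
      ⟨0, 2 + Real.sqrt 3⟩ = ⟨0, 2 + Real.sqrt 3⟩ := by
  have him : (⟨0, 2 + Real.sqrt 3⟩ : ℂ).im ≠ 0 := by
    show (2 + Real.sqrt 3) ≠ 0; positivity
  refine (moebius_rho_eq_self_iff_of_re_eq_zero him rfl _).2 ⟨?_, rfl, ?_⟩
  · intro h; have := congrArg QuaternionAlgebra.imK h; simp at this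
  · have h3 : Real.sqrt 3 ^ 2 = 3 := Real.sq_sqrt (by norm_num)
    show (((-2 : ℚ) : ℝ)) * (1 - (2 + Real.sqrt 3) ^ 2) = Real.sqrt 3 * ((1 : ℚ) : ℝ) * (1 + (2 + Real.sqrt 3) ^ 2)
    push_cast
    linear_combination (-(Real.sqrt 3 + 2)) * h3

/-- **`e₂(Γ₆) = 2` AS A NUMBER**: the quotient of the set of fixed points in `ℌ` of order-`4` elements of `Γ₆` (the
elliptic points of order `2` of `X₆ = Γ₆∖ℌ`, `Γ₆ = O₆¹` acting through `ρ`) by `Γ₆`-equivalence has exactly TWO elements —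
the classes of `I` (fixed by `i`) and of `(2 + √3)I` (fixed by `E = −2i + ij`): distinct by `orderTwo_points_not_equiv`,
exhaustive by `orderTwo_points_complete` and the uniqueness of the fixed point in `ℌ`. Vignéras' table for `D = 2·3`:
«`e₂(Γ) = 2`»; Bayer–Travesa: «The vertices `P₁ ≡ P₃ ≡ P₅ (mod Γ₆)` and `P₆` are elliptic of order `2`».
[cite: VignerasLNM800, Ch. IV §3 A («`e₂ = ∏_{p∣D}(1 − (−4/p))`») and §3 B (table `D = 2·3`: `e₂(Γ) = 2`)] [cite: BayerTravesa2007, §1 Thm. 1.1] -/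
theorem card_orderTwo_points :
    Nat.card (Quot (fun p q : {τ : ℂ // 0 < τ.im ∧ ∃ u : ℍ[ℚ,((-1 : ℤ) : ℚ),((3 : ℤ) : ℚ)],
        (u ∈ order (-1) 3 ∨ u - ⟨1/2, 1/2, 1/2, -1/2⟩ ∈ order (-1) 3) ∧ u * star u = 1 ∧ u.re = 0 ∧
        moebius (rho (-1) 3 (by norm_num) (castQ (-1) 3 u)) τ = τ} ↦
      ∃ v : ℍ[ℚ,((-1 : ℤ) : ℚ),((3 : ℤ) : ℚ)], (v ∈ order (-1) 3 ∨ v - ⟨1/2, 1/2, 1/2, -1/2⟩ ∈ order (-1) 3) ∧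
        v * star v = 1 ∧ moebius (rho (-1) 3 (by norm_num) (castQ (-1) 3 v)) p.1 = q.1)) = 2 := by
  set R := (fun p q : {τ : ℂ // 0 < τ.im ∧ ∃ u : ℍ[ℚ,((-1 : ℤ) : ℚ),((3 : ℤ) : ℚ)],
        (u ∈ order (-1) 3 ∨ u - ⟨1/2, 1/2, 1/2, -1/2⟩ ∈ order (-1) 3) ∧ u * star u = 1 ∧ u.re = 0 ∧
        moebius (rho (-1) 3 (by norm_num) (castQ (-1) 3 u)) τ = τ} ↦
      ∃ v : ℍ[ℚ,((-1 : ℤ) : ℚ),((3 : ℤ) : ℚ)], (v ∈ order (-1) 3 ∨ v - ⟨1/2, 1/2, 1/2, -1/2⟩ ∈ order (-1) 3) ∧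
        v * star v = 1 ∧ moebius (rho (-1) 3 (by norm_num) (castQ (-1) 3 v)) p.1 = q.1) with hR
  have hE : Equivalence R := orderTwo_points_equivalence
  have hiff : ∀ p q, Quot.mk R p = Quot.mk R q ↔ R p q := fun p q ↦ by rw [Quot.eq]; exact hE.eqvGen_iff
  -- the data of `i` and `E`
  have hiO : (⟨0, 1, 0, 0⟩ : ℍ[ℚ,((-1 : ℤ) : ℚ),((3 : ℤ) : ℚ)]) ∈ order (-1) 3 ∨
      (⟨0, 1, 0, 0⟩ : ℍ[ℚ,((-1 : ℤ) : ℚ),((3 : ℤ) : ℚ)]) - ⟨1/2, 1/2, 1/2, -1/2⟩ ∈ order (-1) 3 :=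
    Or.inl ⟨![0, 1, 0, 0], by ext <;> simp [ofCoords]⟩
  have hi1 : (⟨0, 1, 0, 0⟩ : ℍ[ℚ,((-1 : ℤ) : ℚ),((3 : ℤ) : ℚ)]) * star ⟨0, 1, 0, 0⟩ = 1 := by
    rw [QuaternionAlgebra.star_mk, QuaternionAlgebra.mk_mul_mk]; ext <;> norm_num
  have hEO : (⟨0, -2, 0, 1⟩ : ℍ[ℚ,((-1 : ℤ) : ℚ),((3 : ℤ) : ℚ)]) ∈ order (-1) 3 ∨
      (⟨0, -2, 0, 1⟩ : ℍ[ℚ,((-1 : ℤ) : ℚ),((3 : ℤ) : ℚ)]) - ⟨1/2, 1/2, 1/2, -1/2⟩ ∈ order (-1) 3 :=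
    Or.inl ⟨![0, -2, 0, 1], by ext <;> simp [ofCoords]⟩
  have hE1 : (⟨0, -2, 0, 1⟩ : ℍ[ℚ,((-1 : ℤ) : ℚ),((3 : ℤ) : ℚ)]) * star ⟨0, -2, 0, 1⟩ = 1 := by
    rw [QuaternionAlgebra.star_mk, QuaternionAlgebra.mk_mul_mk]; ext <;> norm_num
  have hIim : 0 < Complex.I.im := by simp
  have hτEim : 0 < (⟨0, 2 + Real.sqrt 3⟩ : ℂ).im := by show 0 < 2 + Real.sqrt 3; positivity
  -- the two representatives
  set p₁ : {τ : ℂ // 0 < τ.im ∧ ∃ u : ℍ[ℚ,((-1 : ℤ) : ℚ),((3 : ℤ) : ℚ)],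
        (u ∈ order (-1) 3 ∨ u - ⟨1/2, 1/2, 1/2, -1/2⟩ ∈ order (-1) 3) ∧ u * star u = 1 ∧ u.re = 0 ∧
        moebius (rho (-1) 3 (by norm_num) (castQ (-1) 3 u)) τ = τ} :=
    ⟨Complex.I, hIim, ⟨0, 1, 0, 0⟩, hiO, hi1, rfl, moebius_rho_i_I⟩ with hp₁
  set p₂ : {τ : ℂ // 0 < τ.im ∧ ∃ u : ℍ[ℚ,((-1 : ℤ) : ℚ),((3 : ℤ) : ℚ)],
        (u ∈ order (-1) 3 ∨ u - ⟨1/2, 1/2, 1/2, -1/2⟩ ∈ order (-1) 3) ∧ u * star u = 1 ∧ u.re = 0 ∧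
        moebius (rho (-1) 3 (by norm_num) (castQ (-1) 3 u)) τ = τ} :=
    ⟨⟨0, 2 + Real.sqrt 3⟩, hτEim, ⟨0, -2, 0, 1⟩, hEO, hE1, rfl, moebius_rho_E_axisPoint⟩ with hp₂
  rw [Nat.card_eq_two_iff]
  refine ⟨Quot.mk R p₁, Quot.mk R p₂, ?_, ?_⟩
  · -- distinct
    rw [Ne, hiff]
    rintro ⟨v, hv, hv1, h⟩
    exact orderTwo_points_not_equiv hIim.ne' hτEim.ne' moebius_rho_i_I moebius_rho_E_axisPoint hv hv1 h
  · -- exhaustive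
    rw [Set.eq_univ_iff_forall]
    intro x
    induction x using Quot.ind with
    | _ p =>
      obtain ⟨τ, hτ, u, hu, hu1, hre, hfix⟩ := p
      obtain ⟨v, hv, hv1, h⟩ := orderTwo_points_complete hu hu1 hre hτ.ne' hfix
      have hvτ : 0 < (moebius (rho (-1) 3 (by norm_num) (castQ (-1) 3 v)) τ).im :=
        im_moebius_rho_pos (by norm_num) (norm_pos_of_mul_star_eq_one hv1) hτ
      simp only [Set.mem_insert_iff, Set.mem_singleton_iff]
      rcases h with h | h
      · left
        refine (hiff _ _).2 ⟨v, hv, hv1, ?_⟩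
        exact fixed_unique rfl (norm_pos_of_mul_star_eq_one hi1) hvτ hIim h moebius_rho_i_I
      · right
        refine (hiff _ _).2 ⟨v, hv, hv1, ?_⟩
        exact fixed_unique rfl (norm_pos_of_mul_star_eq_one hE1) hvτ hτEim h moebius_rho_E_axisPoint

end OrderTwo

/-! ## §2 The elliptic points of order `3`: `e₃(Γ₆) = 2` -/

section OrderThree

/-- **`Γ₆`-EQUIVALENCE IS AN EQUIVALENCE RELATION on the fixed points in `ℌ` of the elliptic elements `u ∈ Γ₆`, `u ≠ ±1`,
of non-zero trace** (orders `3` and `6`; `u = ±(1 + x)/2`, `x ∈ L(3)`). [cite: VignerasLNM800, Ch. IV §1 and §3 A] -/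
theorem orderThree_points_equivalence :
    Equivalence (fun p q : {τ : ℂ // 0 < τ.im ∧ ∃ u : ℍ[ℚ,((-1 : ℤ) : ℚ),((3 : ℤ) : ℚ)],
        (u ∈ order (-1) 3 ∨ u - ⟨1/2, 1/2, 1/2, -1/2⟩ ∈ order (-1) 3) ∧ u * star u = 1 ∧ u ≠ 1 ∧ u ≠ -1 ∧ u.re ≠ 0 ∧
        moebius (rho (-1) 3 (by norm_num) (castQ (-1) 3 u)) τ = τ} ↦
      ∃ v : ℍ[ℚ,((-1 : ℤ) : ℚ),((3 : ℤ) : ℚ)], (v ∈ order (-1) 3 ∨ v - ⟨1/2, 1/2, 1/2, -1/2⟩ ∈ order (-1) 3) ∧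
        v * star v = 1 ∧ moebius (rho (-1) 3 (by norm_num) (castQ (-1) 3 v)) p.1 = q.1) where
  refl p := ⟨1, Or.inl (Subring.one_mem _), by rw [star_one, mul_one], moebius_rho_castQ_one _⟩
  symm := by
    rintro p q ⟨v, hv, hv1, h⟩
    refine ⟨star v, star_maxOrder hv, by rw [star_star, star_comm_self' v, hv1], ?_⟩
    rw [← h]
    exact moebius_rho_star_moebius_rho (by norm_num) (norm_pos_of_mul_star_eq_one hv1) (UpperHalfPlane.mk p.1 p.2.1)
  trans := by
    rintro p q r ⟨v, hv, hv1, h1⟩ ⟨w, hw, hw1, h2⟩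
    refine ⟨w * v, maxOrder_mul hw hv, by rw [star_mul, mul_assoc, ← mul_assoc v, hv1, one_mul, hw1], ?_⟩
    rw [moebius_rho_castQ_mul (norm_pos_of_mul_star_eq_one hv1) (norm_pos_of_mul_star_eq_one hw1) p.2.1, h1, h2]

/-- `√3 > 1`, so `τ₃ = ((√3 − 1)/2)(1 + I)` and `τ₃′ = ((1 − √3)/2, (√3 − 1)/2)` lie in `ℌ`. [folklore] -/
private theorem sqrt_three_sub_one_div_two_pos : 0 < (Real.sqrt 3 - 1) / 2 := by
  have h1 : (1 : ℝ) < Real.sqrt 3 := (Real.lt_sqrt zero_le_one).2 (by norm_num)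
  linarith

/-- The fixed point `ρ(i)·τ₃′ ∈ ℌ` of `ρ(R₂)`, `R₂ = 3i + j − ij = i(3i − j + ij)i⁻¹`, transported from the fixed point
`τ₃′ = ((1 − √3)/2, (√3 − 1)/2)` of `ρ(3i − j + ij)` (`moebius_rho_tauThreeBis`). [cite: BayerTravesa2007, §1 Thm. 1.1 (the order-`3` vertices `P₂, P₄`)] -/
theorem moebius_rho_R₂_point :
    moebius (rho (-1) 3 (by norm_num) (castQ (-1) 3 (⟨0, 3, 1, -1⟩ : ℍ[ℚ,((-1 : ℤ) : ℚ),((3 : ℤ) : ℚ)])))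
        (moebius (rho (-1) 3 (by norm_num) (castQ (-1) 3 (⟨0, 1, 0, 0⟩ : ℍ[ℚ,((-1 : ℤ) : ℚ),((3 : ℤ) : ℚ)])))
          ⟨(1 - Real.sqrt 3) / 2, (Real.sqrt 3 - 1) / 2⟩) =
      moebius (rho (-1) 3 (by norm_num) (castQ (-1) 3 (⟨0, 1, 0, 0⟩ : ℍ[ℚ,((-1 : ℤ) : ℚ),((3 : ℤ) : ℚ)])))
        ⟨(1 - Real.sqrt 3) / 2, (Real.sqrt 3 - 1) / 2⟩ := by
  have hi : 0 < ((⟨0, 1, 0, 0⟩ : ℍ[ℚ,((-1 : ℤ) : ℚ),((3 : ℤ) : ℚ)]) * star ⟨0, 1, 0, 0⟩).re := by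
    rw [QuaternionAlgebra.star_mk, QuaternionAlgebra.mk_mul_mk]; norm_num
  have hlam : 0 < ((⟨0, 3, -1, 1⟩ : ℍ[ℚ,((-1 : ℤ) : ℚ),((3 : ℤ) : ℚ)]) * star ⟨0, 3, -1, 1⟩).re := by
    rw [QuaternionAlgebra.star_mk, QuaternionAlgebra.mk_mul_mk]; norm_num
  have hconj : (⟨0, 1, 0, 0⟩ : ℍ[ℚ,((-1 : ℤ) : ℚ),((3 : ℤ) : ℚ)]) * ⟨0, 3, -1, 1⟩ * star ⟨0, 1, 0, 0⟩ = ⟨0, 3, 1, -1⟩ := by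
    rw [QuaternionAlgebra.star_mk, QuaternionAlgebra.mk_mul_mk, QuaternionAlgebra.mk_mul_mk]; ext <;> norm_num
  have h := moebius_conj_fixed (by norm_num) hi (UpperHalfPlane.mk _ sqrt_three_sub_one_div_two_pos)
    (det_rho_castQ_pos _ hlam) moebius_rho_tauThreeBis
  rwa [hconj] at h

/-- **`e₃(Γ₆) = 2` AS A NUMBER**: the quotient of the set of fixed points in `ℌ` of the elliptic elements `u ≠ ±1` of `Γ₆`
with `tr u ≠ 0` (the elliptic points of order `3` of `X₆`) by `Γ₆`-equivalence has exactly TWO elements — the classes of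
`τ₃ = ((√3 − 1)/2)(1 + I)` (fixed by `R₁ = 3i + j + ij`, i.e. by `(1 + R₁)/2 ∈ Γ₆` of order `6`) and of `ρ(i)τ₃′` (fixed by
`R₂ = 3i + j − ij`): distinct by `orderThree_points_not_equiv`, exhaustive by `orderThree_points_complete` and the uniqueness
of the fixed point in `ℌ`. Vignéras' table for `D = 2·3`: «`e₃(Γ) = 2`»; Bayer–Travesa: «the remaining vertices `P₂, P₄` are
elliptic of order `3`». [cite: VignerasLNM800, Ch. IV §3 A («`e₃ = ∏_{p∣D}(1 − (−3/p))`») and §3 B (table `D = 2·3`: `e₃(Γ) = 2`)] [cite: BayerTravesa2007, §1 Thm. 1.1] -/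
theorem card_orderThree_points :
    Nat.card (Quot (fun p q : {τ : ℂ // 0 < τ.im ∧ ∃ u : ℍ[ℚ,((-1 : ℤ) : ℚ),((3 : ℤ) : ℚ)],
        (u ∈ order (-1) 3 ∨ u - ⟨1/2, 1/2, 1/2, -1/2⟩ ∈ order (-1) 3) ∧ u * star u = 1 ∧ u ≠ 1 ∧ u ≠ -1 ∧ u.re ≠ 0 ∧
        moebius (rho (-1) 3 (by norm_num) (castQ (-1) 3 u)) τ = τ} ↦
      ∃ v : ℍ[ℚ,((-1 : ℤ) : ℚ),((3 : ℤ) : ℚ)], (v ∈ order (-1) 3 ∨ v - ⟨1/2, 1/2, 1/2, -1/2⟩ ∈ order (-1) 3) ∧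
        v * star v = 1 ∧ moebius (rho (-1) 3 (by norm_num) (castQ (-1) 3 v)) p.1 = q.1)) = 2 := by
  set R := (fun p q : {τ : ℂ // 0 < τ.im ∧ ∃ u : ℍ[ℚ,((-1 : ℤ) : ℚ),((3 : ℤ) : ℚ)],
        (u ∈ order (-1) 3 ∨ u - ⟨1/2, 1/2, 1/2, -1/2⟩ ∈ order (-1) 3) ∧ u * star u = 1 ∧ u ≠ 1 ∧ u ≠ -1 ∧ u.re ≠ 0 ∧
        moebius (rho (-1) 3 (by norm_num) (castQ (-1) 3 u)) τ = τ} ↦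
      ∃ v : ℍ[ℚ,((-1 : ℤ) : ℚ),((3 : ℤ) : ℚ)], (v ∈ order (-1) 3 ∨ v - ⟨1/2, 1/2, 1/2, -1/2⟩ ∈ order (-1) 3) ∧
        v * star v = 1 ∧ moebius (rho (-1) 3 (by norm_num) (castQ (-1) 3 v)) p.1 = q.1) with hR
  have hE : Equivalence R := orderThree_points_equivalence
  have hiff : ∀ p q, Quot.mk R p = Quot.mk R q ↔ R p q := fun p q ↦ by rw [Quot.eq]; exact hE.eqvGen_iff
  -- data: `R₁ = 3i + j + ij`, `R₂ = 3i + j − ij`, `u₁ = (1 + R₁)/2`, `u₂ = (1 + R₂)/2`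
  have hR₁ : 0 < ((⟨0, 3, 1, 1⟩ : ℍ[ℚ,((-1 : ℤ) : ℚ),((3 : ℤ) : ℚ)]) * star ⟨0, 3, 1, 1⟩).re := by
    rw [QuaternionAlgebra.star_mk, QuaternionAlgebra.mk_mul_mk]; norm_num
  have hR₂ : 0 < ((⟨0, 3, 1, -1⟩ : ℍ[ℚ,((-1 : ℤ) : ℚ),((3 : ℤ) : ℚ)]) * star ⟨0, 3, 1, -1⟩).re := by
    rw [QuaternionAlgebra.star_mk, QuaternionAlgebra.mk_mul_mk]; norm_num
  have hi : 0 < ((⟨0, 1, 0, 0⟩ : ℍ[ℚ,((-1 : ℤ) : ℚ),((3 : ℤ) : ℚ)]) * star ⟨0, 1, 0, 0⟩).re := by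
    rw [QuaternionAlgebra.star_mk, QuaternionAlgebra.mk_mul_mk]; norm_num
  have hu₁O : (⟨1/2, 3/2, 1/2, 1/2⟩ : ℍ[ℚ,((-1 : ℤ) : ℚ),((3 : ℤ) : ℚ)]) ∈ order (-1) 3 ∨
      (⟨1/2, 3/2, 1/2, 1/2⟩ : ℍ[ℚ,((-1 : ℤ) : ℚ),((3 : ℤ) : ℚ)]) - ⟨1/2, 1/2, 1/2, -1/2⟩ ∈ order (-1) 3 :=
    Or.inr ⟨![0, 1, 0, 1], by rw [QuaternionAlgebra.mk_sub_mk]; ext <;> simp [ofCoords] <;> norm_num⟩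
  have hu₂O : (⟨1/2, 3/2, 1/2, -1/2⟩ : ℍ[ℚ,((-1 : ℤ) : ℚ),((3 : ℤ) : ℚ)]) ∈ order (-1) 3 ∨
      (⟨1/2, 3/2, 1/2, -1/2⟩ : ℍ[ℚ,((-1 : ℤ) : ℚ),((3 : ℤ) : ℚ)]) - ⟨1/2, 1/2, 1/2, -1/2⟩ ∈ order (-1) 3 :=
    Or.inr ⟨![0, 1, 0, 0], by rw [QuaternionAlgebra.mk_sub_mk]; ext <;> simp [ofCoords]; norm_num⟩
  have hu₁1 : (⟨1/2, 3/2, 1/2, 1/2⟩ : ℍ[ℚ,((-1 : ℤ) : ℚ),((3 : ℤ) : ℚ)]) * star ⟨1/2, 3/2, 1/2, 1/2⟩ = 1 := by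
    rw [QuaternionAlgebra.star_mk, QuaternionAlgebra.mk_mul_mk]; ext <;> norm_num
  have hu₂1 : (⟨1/2, 3/2, 1/2, -1/2⟩ : ℍ[ℚ,((-1 : ℤ) : ℚ),((3 : ℤ) : ℚ)]) * star ⟨1/2, 3/2, 1/2, -1/2⟩ = 1 := by
    rw [QuaternionAlgebra.star_mk, QuaternionAlgebra.mk_mul_mk]; ext <;> norm_num
  have hne : ∀ s : ℚ, (⟨1/2, 3/2, 1/2, s⟩ : ℍ[ℚ,((-1 : ℤ) : ℚ),((3 : ℤ) : ℚ)]) ≠ 1 ∧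
      (⟨1/2, 3/2, 1/2, s⟩ : ℍ[ℚ,((-1 : ℤ) : ℚ),((3 : ℤ) : ℚ)]) ≠ -1 ∧
      (⟨1/2, 3/2, 1/2, s⟩ : ℍ[ℚ,((-1 : ℤ) : ℚ),((3 : ℤ) : ℚ)]).re ≠ 0 := fun s ↦
    ⟨fun h ↦ by have := congrArg QuaternionAlgebra.imI h; norm_num at this,
     fun h ↦ by have := congrArg QuaternionAlgebra.imI h; norm_num at this, by norm_num⟩
  have hsmul : ∀ s : ℚ, (⟨1/2, 3/2, 1/2, s / 2⟩ : ℍ[ℚ,((-1 : ℤ) : ℚ),((3 : ℤ) : ℚ)]) =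
      (1/2 : ℚ) • (((1 : ℚ) : ℍ[ℚ,((-1 : ℤ) : ℚ),((3 : ℤ) : ℚ)]) + ⟨0, 3, 1, s⟩) := fun s ↦ by
    change _ = (1/2 : ℚ) • ((⟨(1 : ℚ), 0, 0, 0⟩ : ℍ[ℚ,((-1 : ℤ) : ℚ),((3 : ℤ) : ℚ)]) + ⟨0, 3, 1, s⟩)
    rw [QuaternionAlgebra.mk_add_mk, QuaternionAlgebra.smul_mk]
    ext <;> simp only [smul_eq_mul] <;> ring
  -- the two fixed points
  have hτ₃ : 0 < (⟨(Real.sqrt 3 - 1) / 2, (Real.sqrt 3 - 1) / 2⟩ : ℂ).im := sqrt_three_sub_one_div_two_pos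
  have hτ₃' : 0 < (⟨(1 - Real.sqrt 3) / 2, (Real.sqrt 3 - 1) / 2⟩ : ℂ).im := sqrt_three_sub_one_div_two_pos
  have hτ₃'' : 0 < (moebius (rho (-1) 3 (by norm_num) (castQ (-1) 3 (⟨0, 1, 0, 0⟩ : ℍ[ℚ,((-1 : ℤ) : ℚ),((3 : ℤ) : ℚ)])))
      ⟨(1 - Real.sqrt 3) / 2, (Real.sqrt 3 - 1) / 2⟩).im := im_moebius_rho_pos (by norm_num) hi hτ₃'
  -- fixedness under `u₁`, `u₂`
  have hfix₁ : moebius (rho (-1) 3 (by norm_num) (castQ (-1) 3 (⟨1/2, 3/2, 1/2, 1/2⟩ : ℍ[ℚ,((-1 : ℤ) : ℚ),((3 : ℤ) : ℚ)])))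
      ⟨(Real.sqrt 3 - 1) / 2, (Real.sqrt 3 - 1) / 2⟩ = ⟨(Real.sqrt 3 - 1) / 2, (Real.sqrt 3 - 1) / 2⟩ := by
    rw [show (1/2 : ℚ) = 1 / 2 from rfl, show (⟨1/2, 3/2, 1/2, 1/2⟩ : ℍ[ℚ,((-1 : ℤ) : ℚ),((3 : ℤ) : ℚ)]) =
      ⟨1/2, 3/2, 1/2, 1 / 2⟩ from rfl, hsmul 1,
      moebius_rho_smul_eq_self_iff (by norm_num) _ (by norm_num),
      moebius_rho_coe_add_eq_self_iff (by norm_num) rfl hR₁ 1 hτ₃.ne']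
    exact moebius_rho_tauThree
  have hfix₂ : moebius (rho (-1) 3 (by norm_num) (castQ (-1) 3 (⟨1/2, 3/2, 1/2, -1/2⟩ : ℍ[ℚ,((-1 : ℤ) : ℚ),((3 : ℤ) : ℚ)])))
      (moebius (rho (-1) 3 (by norm_num) (castQ (-1) 3 (⟨0, 1, 0, 0⟩ : ℍ[ℚ,((-1 : ℤ) : ℚ),((3 : ℤ) : ℚ)])))
        ⟨(1 - Real.sqrt 3) / 2, (Real.sqrt 3 - 1) / 2⟩) =
      moebius (rho (-1) 3 (by norm_num) (castQ (-1) 3 (⟨0, 1, 0, 0⟩ : ℍ[ℚ,((-1 : ℤ) : ℚ),((3 : ℤ) : ℚ)])))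
        ⟨(1 - Real.sqrt 3) / 2, (Real.sqrt 3 - 1) / 2⟩ := by
    rw [show (⟨1/2, 3/2, 1/2, -1/2⟩ : ℍ[ℚ,((-1 : ℤ) : ℚ),((3 : ℤ) : ℚ)]) = ⟨1/2, 3/2, 1/2, (-1) / 2⟩ by ext <;> norm_num,
      hsmul (-1), moebius_rho_smul_eq_self_iff (by norm_num) _ (by norm_num),
      moebius_rho_coe_add_eq_self_iff (by norm_num) rfl hR₂ 1 hτ₃''.ne']
    exact moebius_rho_R₂_point
  -- the two representatives
  set q₁ : {τ : ℂ // 0 < τ.im ∧ ∃ u : ℍ[ℚ,((-1 : ℤ) : ℚ),((3 : ℤ) : ℚ)],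
        (u ∈ order (-1) 3 ∨ u - ⟨1/2, 1/2, 1/2, -1/2⟩ ∈ order (-1) 3) ∧ u * star u = 1 ∧ u ≠ 1 ∧ u ≠ -1 ∧ u.re ≠ 0 ∧
        moebius (rho (-1) 3 (by norm_num) (castQ (-1) 3 u)) τ = τ} :=
    ⟨_, hτ₃, _, hu₁O, hu₁1, (hne (1/2)).1, (hne (1/2)).2.1, (hne (1/2)).2.2, hfix₁⟩ with hq₁
  set q₂ : {τ : ℂ // 0 < τ.im ∧ ∃ u : ℍ[ℚ,((-1 : ℤ) : ℚ),((3 : ℤ) : ℚ)],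
        (u ∈ order (-1) 3 ∨ u - ⟨1/2, 1/2, 1/2, -1/2⟩ ∈ order (-1) 3) ∧ u * star u = 1 ∧ u ≠ 1 ∧ u ≠ -1 ∧ u.re ≠ 0 ∧
        moebius (rho (-1) 3 (by norm_num) (castQ (-1) 3 u)) τ = τ} :=
    ⟨_, hτ₃'', _, hu₂O, hu₂1, (hne (-1/2)).1, (hne (-1/2)).2.1, (hne (-1/2)).2.2, hfix₂⟩ with hq₂
  rw [Nat.card_eq_two_iff]
  refine ⟨Quot.mk R q₁, Quot.mk R q₂, ?_, ?_⟩
  · -- distinct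
    rw [Ne, hiff]
    rintro ⟨v, hv, hv1, h⟩
    exact orderThree_points_not_equiv hτ₃.ne' hτ₃''.ne' moebius_rho_tauThree moebius_rho_R₂_point hv hv1 h
  · -- exhaustive
    rw [Set.eq_univ_iff_forall]
    intro x
    induction x using Quot.ind with
    | _ p =>
      obtain ⟨τ, hτ, u, hu, hu1, h1, h1', hre, hfix⟩ := p
      obtain ⟨v, hv, hv1, h⟩ := orderThree_points_complete hu hu1 h1 h1' hre hτ.ne' hfix
      have hvτ : 0 < (moebius (rho (-1) 3 (by norm_num) (castQ (-1) 3 v)) τ).im :=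
        im_moebius_rho_pos (by norm_num) (norm_pos_of_mul_star_eq_one hv1) hτ
      simp only [Set.mem_insert_iff, Set.mem_singleton_iff]
      rcases h with h | h
      · left
        refine (hiff _ _).2 ⟨v, hv, hv1, ?_⟩
        exact fixed_unique rfl hR₁ hvτ hτ₃ h moebius_rho_tauThree
      · right
        refine (hiff _ _).2 ⟨v, hv, hv1, ?_⟩
        exact fixed_unique rfl hR₂ hvτ hτ₃'' h moebius_rho_R₂_point

end OrderThree

/-! ## §3 Vignéras' table entries, as numbers -/

/-- **`(e₂(Γ₆), e₃(Γ₆)) = (2, 2)`** — the two counts together, the formal content of the row `D = 2·3` of Vignéras'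
table («`e₂(Γ) = 2`, `e₃(Γ) = 2`», with `g_Γ = 0`) and of Bayer–Travesa's Thm. 1.1 (two elliptic points of each
order on `X₆`); the arithmetic `e_q = ∏_{p∣6}(1 − (−d_q/p))` is `vigneras_table_D_six`.
[cite: VignerasLNM800, Ch. IV §3 B (table `D = 2·3`)] [cite: BayerTravesa2007, §1 Thm. 1.1] -/
theorem ellipticPoints_count_X_six :
    Nat.card (Quot (fun p q : {τ : ℂ // 0 < τ.im ∧ ∃ u : ℍ[ℚ,((-1 : ℤ) : ℚ),((3 : ℤ) : ℚ)],
        (u ∈ order (-1) 3 ∨ u - ⟨1/2, 1/2, 1/2, -1/2⟩ ∈ order (-1) 3) ∧ u * star u = 1 ∧ u.re = 0 ∧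
        moebius (rho (-1) 3 (by norm_num) (castQ (-1) 3 u)) τ = τ} ↦
      ∃ v : ℍ[ℚ,((-1 : ℤ) : ℚ),((3 : ℤ) : ℚ)], (v ∈ order (-1) 3 ∨ v - ⟨1/2, 1/2, 1/2, -1/2⟩ ∈ order (-1) 3) ∧
        v * star v = 1 ∧ moebius (rho (-1) 3 (by norm_num) (castQ (-1) 3 v)) p.1 = q.1)) = 2 ∧
    Nat.card (Quot (fun p q : {τ : ℂ // 0 < τ.im ∧ ∃ u : ℍ[ℚ,((-1 : ℤ) : ℚ),((3 : ℤ) : ℚ)],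
        (u ∈ order (-1) 3 ∨ u - ⟨1/2, 1/2, 1/2, -1/2⟩ ∈ order (-1) 3) ∧ u * star u = 1 ∧ u ≠ 1 ∧ u ≠ -1 ∧ u.re ≠ 0 ∧
        moebius (rho (-1) 3 (by norm_num) (castQ (-1) 3 u)) τ = τ} ↦
      ∃ v : ℍ[ℚ,((-1 : ℤ) : ℚ),((3 : ℤ) : ℚ)], (v ∈ order (-1) 3 ∨ v - ⟨1/2, 1/2, 1/2, -1/2⟩ ∈ order (-1) 3) ∧
        v * star v = 1 ∧ moebius (rho (-1) 3 (by norm_num) (castQ (-1) 3 v)) p.1 = q.1)) = 2 :=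
  ⟨card_orderTwo_points, card_orderThree_points⟩

end Literature.Geometry.Kaehler.ComplexTorus.QuaternionType
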